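import Summits.CriticalPhenomena.PercolationContinuityZ3.Theorems.PercAnnulusCrossingNoiseHypercontractive
import HarnessLib

/-!
# RSW3 lane (lead, gen 22): HYPERCONTRACTIVITY OF THE NOISE OPERATOR, II — the Bonami–Beckner `(2,4)` inequality
# `E_p[(T_ε f)⁴] ≤ (E_p[f²])²` on every finite p-biased cube (degenerate coordinates allowed)

builds on p205010 (kernel theorem, internal audit signed; external expert review pending) — NOT used in this file (abstract).

Cell `prim-rsw3` (LANE 3), lead seat, gen 22.  Support file (`--supports stmt-CriticalPhenomena-4575`); no definitions, no named facts,
no sorries.  With the two-point inequality and the splitting identities of part I (`…NoiseHypercontractive`), the noise operator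

  `T_ε f (x) = Σ_y Σ_m wt_p(y)·wt_ε̄(m)·f(ω^m(x,y))`   (each coordinate independently resampled with probability `ε`; `ρ = 1 − ε`)

satisfies, for every `p ∈ [0,1]^ι` and every `ε` with `(1−ε)² ≤ 1/4` and `3(1−ε)⁴ ≤ p_i(1−p_i)` at each nondegenerate coordinate `i`:

* **`bonami_fin`** (`ι = Fin n`, induction on `n`: `E[(T f)⁴] = E'[E_b(T'g + ρ r(b) T'h)⁴] ≤ E'[(T'g)⁴ + 2(T'g)²(T'h)² + (T'h)⁴]
  ≤ (E'g²)² + 2E'g²E'h² + (E'h²)² = (E f²)²`, Cauchy–Schwarz for the mixed term);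
* **`noise_fourth_moment_le_sq`** (every finite `ι`, transport along `ι ≃ Fin |ι|`):

      **`E_p[(T_ε f)⁴] ≤ (E_p[f²])²`**,  i.e.  `‖T_ρ f‖₄ ≤ ‖f‖₂`  — the `(2,4)` hypercontractive inequality of Bonami and Beckner
      for the p-biased cube with a `p`-dependent `ρ` (on the lane's lattice cube at `p_c(ℤ³) ∈ (0.2,0.3)`: every `ρ ≤ 0.48`).

This is the tool the lane's gen-21 HANDOFF listed as 'not in reach' (hypercontractive inequalities on the p-biased cube); part III
(`…NoiseSmallSets`) derives the `(4/3,2)` form for indicators, the level-`k` inequality and the small-set expansion of the noisy cube,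
part IV the percolation instances.

References: A. Bonami, Ann. Inst. Fourier 20 (1970), Ch. III Lemme 3; W. Beckner, Ann. Math. 102 (1975) (the two-point inequality);
R. O'Donnell, *Analysis of Boolean Functions*, CUP 2014, §9.1 Thm 9.21, §10.1 Thm 10.21; C. Garban, J. Steif, *Noise sensitivity of
Boolean functions and percolation*, CUP 2014, Ch. V Thm V.2.
-/

noncomputable section

namespace Summit.CriticalPhenomena.PercolationContinuityZ3.Theorems.Crossing.Spectral

open Finset Function
open Literature.Probability.ODonnellSaksSchrammServedio2005

/-! ## §3 The Bonami–Beckner `(2,4)` inequality -/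

/-- **THE BONAMI–BECKNER `(2,4)` INEQUALITY ON `{0,1}^n`** (biases `p_i ∈ [0,1]`, by induction on `n`): if `(1−ε)² ≤ 1/4` and
`3(1−ε)⁴ ≤ p_i(1−p_i)` at every nondegenerate coordinate, then `E_p[(T_ε f)⁴] ≤ (E_p[f²])²`.
[cite: Bonami1970, Ch. III Lemme 3] [cite: ODonnell2014, §9.1 Thm 9.21 (induction on n) and §10.1 Thm 10.21 (biased bits)] -/
theorem bonami_fin : ∀ (n : ℕ) (p : Fin n → ℝ), (∀ i, 0 ≤ p i) → (∀ i, p i ≤ 1) → ∀ (ε : ℝ), (1 - ε) ^ 2 ≤ 1 / 4 →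
    (∀ i, 0 < p i → p i < 1 → 3 * (1 - ε) ^ 4 ≤ p i * (1 - p i)) → ∀ (f : (Fin n → Bool) → ℝ),
    ∑ x : Fin n → Bool, wt p x * (∑ y : Fin n → Bool, ∑ m : Fin n → Bool, wt p y * wt (fun _ => ε) m
        * f (fun i => if m i = true then y i else x i)) ^ 4
      ≤ (∑ x : Fin n → Bool, wt p x * f x ^ 2) ^ 2 := by
  intro n
  induction n with
  | zero =>
    intro p h0 h1 ε hρ2 hρ4 f
    have hmix : ∀ x y m : Fin 0 → Bool, (fun i => if m i = true then y i else x i) = x :=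
      fun x y m => funext fun i => Fin.elim0 i
    have hwt : ∀ (q : Fin 0 → ℝ) (x : Fin 0 → Bool), wt q x = 1 := fun q x => by
      unfold wt; exact Fin.prod_univ_zero _
    have huniq : ∀ F : (Fin 0 → Bool) → ℝ, ∑ x : Fin 0 → Bool, F x = F (fun i => Fin.elim0 i) := fun F => by
      rw [Fintype.sum_unique]; exact congrArg F (Subsingleton.elim _ _)
    simp only [hmix, hwt, one_mul, huniq]
    nlinarith [sq_nonneg (f (fun i => Fin.elim0 i))]
  | succ n ih =>
    intro p h0 h1 ε hρ2 hρ4 f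
    have h0' : ∀ i : Fin n, 0 ≤ (fun i : Fin n => p i.succ) i := fun i => h0 i.succ
    have h1' : ∀ i : Fin n, (fun i : Fin n => p i.succ) i ≤ 1 := fun i => h1 i.succ
    have hρ4' : ∀ i : Fin n, 0 < (fun i : Fin n => p i.succ) i → (fun i : Fin n => p i.succ) i < 1 →
        3 * (1 - ε) ^ 4 ≤ (fun i : Fin n => p i.succ) i * (1 - (fun i : Fin n => p i.succ) i) := fun i => hρ4 i.succ
    -- the two functions of the remaining coordinates
    set g : (Fin n → Bool) → ℝ := fun z => ∑ c : Bool, coordWt p 0 c * f (Fin.cons c z) with hg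
    set h : (Fin n → Bool) → ℝ := fun z => ∑ c : Bool, coordWt p 0 c *
      ((((if c then (1 : ℝ) else 0) - p 0) / Real.sqrt (p 0 * (1 - p 0))) * f (Fin.cons c z)) with hh
    have ihg := ih (fun i : Fin n => p i.succ) h0' h1' ε hρ2 hρ4' g
    have ihh := ih (fun i : Fin n => p i.succ) h0' h1' ε hρ2 hρ4' h
    -- abbreviations for the noised functions of the remaining coordinates
    set Tg : (Fin n → Bool) → ℝ := fun x' => ∑ y' : Fin n → Bool, ∑ m' : Fin n → Bool,
      wt (fun i : Fin n => p i.succ) y' * wt (fun _ => ε) m' * g (fun i => if m' i = true then y' i else x' i) with hTg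
    set Th : (Fin n → Bool) → ℝ := fun x' => ∑ y' : Fin n → Bool, ∑ m' : Fin n → Bool,
      wt (fun i : Fin n => p i.succ) y' * wt (fun _ => ε) m' * h (fun i => if m' i = true then y' i else x' i) with hTh
    have hwt0 : ∀ x' : Fin n → Bool, 0 ≤ wt (fun i : Fin n => p i.succ) x' := fun x' => wt_nonneg h0' h1' x'
    -- the right side: `E f² = E'g² + E'h²`
    have hRHS : ∑ x : Fin (n + 1) → Bool, wt p x * f x ^ 2
        = ∑ x' : Fin n → Bool, wt (fun i : Fin n => p i.succ) x' * (g x' ^ 2 + h x' ^ 2) := by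
      rw [sum_wt_eq_sum_cons p (fun x => f x ^ 2)]
      simp only [Finset.mul_sum]
      rw [Finset.sum_comm]
      refine Finset.sum_congr rfl fun x' _ => ?_
      have h2 := second_moment_cons p h0 h1 f x'
      calc ∑ b : Bool, coordWt p 0 b * (wt (fun i : Fin n => p i.succ) x' * f (Fin.cons b x') ^ 2)
          = wt (fun i : Fin n => p i.succ) x' * ∑ b : Bool, coordWt p 0 b * f (Fin.cons b x') ^ 2 := by
            rw [Finset.mul_sum]; exact Finset.sum_congr rfl fun b _ => by ring
        _ = wt (fun i : Fin n => p i.succ) x' * (g x' ^ 2 + h x' ^ 2) := by rw [h2]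
    -- the left side, pointwise in `x'`
    have hLHS : ∑ x : Fin (n + 1) → Bool, wt p x * (∑ y : Fin (n + 1) → Bool, ∑ m : Fin (n + 1) → Bool,
          wt p y * wt (fun _ => ε) m * f (fun i => if m i = true then y i else x i)) ^ 4
        = ∑ x' : Fin n → Bool, wt (fun i : Fin n => p i.succ) x' * ∑ b : Bool, coordWt p 0 b *
            (∑ y : Fin (n + 1) → Bool, ∑ m : Fin (n + 1) → Bool, wt p y * wt (fun _ => ε) m
              * f (fun i => if m i = true then y i else (Fin.cons b x' : Fin (n + 1) → Bool) i)) ^ 4 := by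
      rw [sum_wt_eq_sum_cons p]
      simp only [Finset.mul_sum]
      rw [Finset.sum_comm]
      exact Finset.sum_congr rfl fun x' _ => Finset.sum_congr rfl fun b _ => by ring
    have hpt : ∀ x' : Fin n → Bool, ∑ b : Bool, coordWt p 0 b *
            (∑ y : Fin (n + 1) → Bool, ∑ m : Fin (n + 1) → Bool, wt p y * wt (fun _ => ε) m
              * f (fun i => if m i = true then y i else (Fin.cons b x' : Fin (n + 1) → Bool) i)) ^ 4
        ≤ Tg x' ^ 4 + 2 * (Tg x' ^ 2 * Th x' ^ 2) + Th x' ^ 4 := by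
      intro x'
      have h4 := fourth_moment_cons_le p h0 h1 hρ2 (hρ4 0) f x'
      rw [hTg, hTh, hg, hh]
      exact h4
    rw [hLHS, hRHS]
    -- sum the pointwise bound
    have hstep1 : ∑ x' : Fin n → Bool, wt (fun i : Fin n => p i.succ) x' * ∑ b : Bool, coordWt p 0 b *
            (∑ y : Fin (n + 1) → Bool, ∑ m : Fin (n + 1) → Bool, wt p y * wt (fun _ => ε) m
              * f (fun i => if m i = true then y i else (Fin.cons b x' : Fin (n + 1) → Bool) i)) ^ 4
        ≤ ∑ x' : Fin n → Bool, wt (fun i : Fin n => p i.succ) x' * (Tg x' ^ 4 + 2 * (Tg x' ^ 2 * Th x' ^ 2) + Th x' ^ 4) :=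
      Finset.sum_le_sum fun x' _ => mul_le_mul_of_nonneg_left (hpt x') (hwt0 x')
    refine hstep1.trans ?_
    -- Cauchy–Schwarz for the mixed term and the induction hypothesis
    have hE4g : ∑ x' : Fin n → Bool, wt (fun i : Fin n => p i.succ) x' * Tg x' ^ 4
        ≤ (∑ x' : Fin n → Bool, wt (fun i : Fin n => p i.succ) x' * g x' ^ 2) ^ 2 := by rw [hTg]; exact ihg
    have hE4h : ∑ x' : Fin n → Bool, wt (fun i : Fin n => p i.succ) x' * Th x' ^ 4
        ≤ (∑ x' : Fin n → Bool, wt (fun i : Fin n => p i.succ) x' * h x' ^ 2) ^ 2 := by rw [hTh]; exact ihh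
    have hG0 : 0 ≤ ∑ x' : Fin n → Bool, wt (fun i : Fin n => p i.succ) x' * g x' ^ 2 :=
      Finset.sum_nonneg fun x' _ => mul_nonneg (hwt0 x') (sq_nonneg _)
    have hH0 : 0 ≤ ∑ x' : Fin n → Bool, wt (fun i : Fin n => p i.succ) x' * h x' ^ 2 :=
      Finset.sum_nonneg fun x' _ => mul_nonneg (hwt0 x') (sq_nonneg _)
    have hCS : (∑ x' : Fin n → Bool, wt (fun i : Fin n => p i.succ) x' * (Tg x' ^ 2 * Th x' ^ 2)) ^ 2
        ≤ (∑ x' : Fin n → Bool, wt (fun i : Fin n => p i.succ) x' * Tg x' ^ 4)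
          * ∑ x' : Fin n → Bool, wt (fun i : Fin n => p i.succ) x' * Th x' ^ 4 :=
      Finset.sum_sq_le_sum_mul_sum_of_sq_le_mul _
        (fun x' _ => mul_nonneg (hwt0 x') (by positivity)) (fun x' _ => mul_nonneg (hwt0 x') (by positivity))
        (fun x' _ => le_of_eq (by ring))
    have hmix0 : 0 ≤ ∑ x' : Fin n → Bool, wt (fun i : Fin n => p i.succ) x' * (Tg x' ^ 2 * Th x' ^ 2) :=
      Finset.sum_nonneg fun x' _ => mul_nonneg (hwt0 x') (by positivity)
    have hmixle : ∑ x' : Fin n → Bool, wt (fun i : Fin n => p i.succ) x' * (Tg x' ^ 2 * Th x' ^ 2)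
        ≤ (∑ x' : Fin n → Bool, wt (fun i : Fin n => p i.succ) x' * g x' ^ 2)
          * ∑ x' : Fin n → Bool, wt (fun i : Fin n => p i.succ) x' * h x' ^ 2 := by
      have hsq : (∑ x' : Fin n → Bool, wt (fun i : Fin n => p i.succ) x' * (Tg x' ^ 2 * Th x' ^ 2)) ^ 2
          ≤ ((∑ x' : Fin n → Bool, wt (fun i : Fin n => p i.succ) x' * g x' ^ 2)
              * ∑ x' : Fin n → Bool, wt (fun i : Fin n => p i.succ) x' * h x' ^ 2) ^ 2 := by
        rw [mul_pow]
        exact hCS.trans (mul_le_mul hE4g hE4h (Finset.sum_nonneg fun x' _ => mul_nonneg (hwt0 x') (by positivity))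
          (sq_nonneg _))
      exact (pow_le_pow_iff_left₀ hmix0 (mul_nonneg hG0 hH0) two_ne_zero).1 hsq
    have hsplit : ∑ x' : Fin n → Bool, wt (fun i : Fin n => p i.succ) x' * (Tg x' ^ 4 + 2 * (Tg x' ^ 2 * Th x' ^ 2) + Th x' ^ 4)
        = (∑ x' : Fin n → Bool, wt (fun i : Fin n => p i.succ) x' * Tg x' ^ 4)
          + 2 * (∑ x' : Fin n → Bool, wt (fun i : Fin n => p i.succ) x' * (Tg x' ^ 2 * Th x' ^ 2))
          + ∑ x' : Fin n → Bool, wt (fun i : Fin n => p i.succ) x' * Th x' ^ 4 := by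
      simp only [mul_add, Finset.sum_add_distrib, Finset.mul_sum]
      congr 1; congr 1
      exact Finset.sum_congr rfl fun x' _ => by ring
    have hsplit2 : ∑ x' : Fin n → Bool, wt (fun i : Fin n => p i.succ) x' * (g x' ^ 2 + h x' ^ 2)
        = (∑ x' : Fin n → Bool, wt (fun i : Fin n => p i.succ) x' * g x' ^ 2)
          + ∑ x' : Fin n → Bool, wt (fun i : Fin n => p i.succ) x' * h x' ^ 2 := by
      simp only [mul_add, Finset.sum_add_distrib]
    rw [hsplit, hsplit2]
    nlinarith [hE4g, hE4h, hmixle]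

/-- **THE BONAMI–BECKNER `(2,4)` HYPERCONTRACTIVE INEQUALITY ON THE BOX CUBE** (every finite index type `ι`, biases `p_i ∈ [0,1]`,
degenerate coordinates allowed): if `(1−ε)² ≤ 1/4` and `3(1−ε)⁴ ≤ p_i(1−p_i)` at every nondegenerate coordinate, then for every
`f : {0,1}^ι → ℝ`

  **`E_p[(T_ε f)⁴] ≤ (E_p[f²])²`**,   i.e. `‖T_ρ f‖₄ ≤ ‖f‖₂` for the noise operator `T_ε f(x) = E_{y,m} f(ω^m(x,y))`, `ρ = 1 − ε`.

(Transport of `bonami_fin` along `ι ≃ Fin |ι|`.) [cite: Bonami1970, Ch. III Lemme 3] [cite: ODonnell2014, §9.1 Thm 9.21 and §10.1 Thm 10.21]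
[cite: GarbanSteif2014, Ch. V Thm V.2 (hypercontractivity, the tool behind KKL and BKS)] -/
theorem noise_fourth_moment_le_sq {ι : Type*} [Fintype ι] [DecidableEq ι] (p : ι → ℝ) (h0 : ∀ i, 0 ≤ p i) (h1 : ∀ i, p i ≤ 1)
    {ε : ℝ} (hρ2 : (1 - ε) ^ 2 ≤ 1 / 4) (hρ4 : ∀ i, 0 < p i → p i < 1 → 3 * (1 - ε) ^ 4 ≤ p i * (1 - p i))
    (f : (ι → Bool) → ℝ) :
    ∑ x : ι → Bool, wt p x * (∑ y : ι → Bool, ∑ m : ι → Bool, wt p y * wt (fun _ => ε) m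
        * f (fun i => if m i = true then y i else x i)) ^ 4
      ≤ (∑ x : ι → Bool, wt p x * f x ^ 2) ^ 2 := by
  classical
  -- reindex along `e : ι ≃ Fin N`
  set N : ℕ := Fintype.card ι
  set e : ι ≃ Fin N := Fintype.equivFin ι with he
  set E : (ι → Bool) ≃ (Fin N → Bool) := e.arrowCongr (Equiv.refl Bool) with hE
  have hEapp : ∀ (x : ι → Bool) (j : Fin N), E x j = x (e.symm j) := fun x j => rfl
  have hEsymm : ∀ (z : Fin N → Bool) (i : ι), E.symm z i = z (e i) := fun z i => rfl
  set p' : Fin N → ℝ := fun j => p (e.symm j) with hp'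
  set f' : (Fin N → Bool) → ℝ := fun z => f (E.symm z) with hf'
  -- weights
  have hwt : ∀ (q : ι → ℝ) (x : ι → Bool), wt q x = wt (fun j => q (e.symm j)) (E x) := by
    intro q x
    unfold wt
    rw [← Fintype.prod_equiv e.symm (fun j => coordWt (fun j => q (e.symm j)) j (E x j)) (fun i => coordWt q i (x i))]
    intro j
    simp only [coordWt, hEapp]
  have hf : ∀ x : ι → Bool, f x = f' (E x) := fun x => by rw [hf']; simp
  have hmix : ∀ x y m : ι → Bool, E (fun i => if m i = true then y i else x i)
      = fun j => if E m j = true then E y j else E x j := fun x y m => by funext j; simp only [hEapp]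
  -- the inner double sum
  have hinner : ∀ x : ι → Bool, ∑ y : ι → Bool, ∑ m : ι → Bool, wt p y * wt (fun _ => ε) m
        * f (fun i => if m i = true then y i else x i)
      = ∑ y' : Fin N → Bool, ∑ m' : Fin N → Bool, wt p' y' * wt (fun _ => ε) m'
        * f' (fun j => if m' j = true then y' j else E x j) := by
    intro x
    rw [← Equiv.sum_comp E]
    refine Finset.sum_congr rfl fun y _ => ?_
    rw [← Equiv.sum_comp E]
    refine Finset.sum_congr rfl fun m _ => ?_
    rw [hwt p y, hwt (fun _ => ε) m, hf, hmix]
  have hL : ∑ x : ι → Bool, wt p x * (∑ y : ι → Bool, ∑ m : ι → Bool, wt p y * wt (fun _ => ε) m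
        * f (fun i => if m i = true then y i else x i)) ^ 4
      = ∑ x' : Fin N → Bool, wt p' x' * (∑ y' : Fin N → Bool, ∑ m' : Fin N → Bool, wt p' y' * wt (fun _ => ε) m'
        * f' (fun j => if m' j = true then y' j else x' j)) ^ 4 := by
    rw [← Equiv.sum_comp E]
    exact Finset.sum_congr rfl fun x _ => by rw [hwt p x, hinner x]
  have hR : ∑ x : ι → Bool, wt p x * f x ^ 2 = ∑ x' : Fin N → Bool, wt p' x' * f' x' ^ 2 := by
    rw [← Equiv.sum_comp E]
    exact Finset.sum_congr rfl fun x _ => by rw [hwt p x, hf x]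
  rw [hL, hR]
  exact bonami_fin N p' (fun j => h0 _) (fun j => h1 _) ε hρ2 (fun j => hρ4 _) f'

end Summit.CriticalPhenomena.PercolationContinuityZ3.Theorems.Crossing.Spectral

end
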